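import Summits.AtomisticToContinuum.BoseEinsteinCondensation.Theorems.BECInsertionCorrectorStaticResponseBoundModulationTwoPoint
import HarnessLib

/-!
# Modulated minimisers on the torus, IV: a weighted Poincaré constant, the half-wavelength
# translation, and two lemmas of real analysis (support for stub S3 `ModulationBootstrap`,
# item stmt-AtomisticToContinuum-12057)

Part 4 of 5. `exists_poincareConst` — a variance inequality `∫φ²|Φ|² - (∫φ|Φ|²)² ≤ C∫|∇φ|²|Φ|²`
for a positive continuous periodic weight (Neumann gap of the cube, `Poincare.isPoincare_config`);
`exists_translate_cosMean_eq_neg` — translating all bosons by `τ = Lk/(2|k|²)` (`k ≠ 0`) preserves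
the energy and flips the sign of `⟨∑ⱼcos(p·xⱼ)⟩`; `le_of_local_lower_bound` (a Dini lemma from
`image_le_of_liminf_slope_right_le_deriv_boundary`) and `le_of_lower_tangent_of_monotone`
(discrete Taylor formula: lower tangents + `f + 2K·` non-decreasing ⇒ `e(t) ≥ e(0) + tf(0) - Kt²`).

References: [Kato1966] VII §3; [LSSY2005] (Neumann gap, via LiebYngvasonPoincare).
-/

noncomputable section

namespace Summit.AtomisticToContinuum.BoseEinsteinCondensation.Cruxes.StaticResponseBound.UvThomsonForceWave

open MeasureTheory Filter Metric
open scoped ENNReal NNReal BigOperators Topology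
open Literature.MathematicalPhysics.QuantumManyBody.BoseGas
open Summit.AtomisticToContinuum.BoseEinsteinCondensation.Theses.BECInsertionCorrector
open Summit.AtomisticToContinuum.BoseEinsteinCondensation.Theorems.StaticResponseBound.Negative

variable {N : ℕ} {L : ℝ}

/-! ### A weighted Poincaré constant for a positive continuous weight (Neumann gap of the cell) -/

section Poincare

/-- **Weighted Poincaré (variance) inequality for `|Φ|² dX`.** For a pointwise non-vanishing real
periodic state `Φ` on a cell of side `L > 0` there is `C ≥ 0` with
`∫φ²|Φ|² - (∫φ|Φ|²)² ≤ C ∫|∇φ|²|Φ|²` for every periodic `C¹` test function `φ` (the flat Neumann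
gap `π²/L²` of the cube, `Poincare.isPoincare_config`, transferred to the weight by
`min_cell|Φ|² ≤ |Φ|² ≤ max_cell|Φ|²`; `C = (max|Φ|/min|Φ|)² (L/π)²`). [folklore] -/
theorem exists_poincareConst (hL : 0 < L) (Φ : PeriodicTrialState N L)
    (hreal : ∀ X, Φ.ψ X = (‖Φ.ψ X‖ : ℂ)) (hpos : ∀ X, Φ.ψ X ≠ 0) :
    ∃ C : ℝ, 0 ≤ C ∧ ∀ φ : Config N → ℝ, IsPeriodicTest L φ →
      (∫ X in cellN N L, φ X ^ 2 * ‖Φ.ψ X‖ ^ 2) - (∫ X in cellN N L, φ X * ‖Φ.ψ X‖ ^ 2) ^ 2 ≤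
        C * dirichletFormW L (fun X => ‖Φ.ψ X‖) φ φ := by
  set F : Config N → ℝ := fun X => ‖Φ.ψ X‖ with hFdef
  have hF : ContDiff ℝ 1 F := contDiff_norm_of_real Φ hreal
  have hFc : Continuous F := hF.continuous
  have hFpos : ∀ X, 0 < F X := fun X => norm_pos_iff.2 (hpos X)
  obtain ⟨M, hM0, hM⟩ := exists_bound_on_cellN hFc L
  obtain ⟨X₀, -, hX₀⟩ := (isCompact_closedBall (0 : Config N) (2 * |L|)).exists_isMinOn
    ⟨0, mem_closedBall_self (by positivity)⟩ hFc.continuousOn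
  have hmpos : 0 < F X₀ := hFpos X₀
  have hmle : ∀ X ∈ cellN N L, F X₀ ≤ F X := fun X hX =>
    (isMinOn_iff.1 hX₀) X (cellN_subset_closedBall N L hX)
  refine ⟨M ^ 2 * (L / Real.pi) ^ 2 / F X₀ ^ 2, by positivity, fun φ hφ => ?_⟩
  -- flat Poincaré on the box for a bounded modification `g` of `φ`
  obtain ⟨g, hg, hgeq⟩ := Poincare.exists_bddC1_eq_of_contDiff (E := ℝ) hφ.contDiff
    (R := 2 * |L| + 1) (by positivity)
  have hsub : cellN N L ⊆ ball (0 : Config N) (2 * |L| + 1) := fun X hX => by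
    have h := cellN_subset_closedBall N L hX
    rw [mem_closedBall] at h
    rw [mem_ball]
    linarith
  have heq : ∀ X ∈ cellN N L, g X = φ X := fun X hX => (hgeq X (hsub hX)).1
  have heq' : ∀ X ∈ cellN N L, fderiv ℝ g X = fderiv ℝ φ X := fun X hX => (hgeq X (hsub hX)).2
  have hPg := Poincare.isPoincare_config (E := ℝ) hL N g hg
  set c : ℝ := ⨍ Y in boxN N L, g Y with hc
  have hcell : ∀ f : Config N → ℝ, ∫ X in boxN N L, f X = ∫ X in cellN N L, f X := fun f =>
    setIntegral_congr_set (boxN_ae_eq_cellN N L)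
  have h1 : ∫ X in cellN N L, (φ X - c) ^ 2 ≤
      (L / Real.pi) ^ 2 * ∫ X in cellN N L, gradDot φ φ X := by
    have hl : ∫ X in boxN N L, ‖g X - c‖ ^ 2 = ∫ X in cellN N L, (φ X - c) ^ 2 := by
      rw [hcell]
      exact setIntegral_congr_fun (measurableSet_cellN N L) fun X hX => by
        simp only [heq X hX, Real.norm_eq_abs, sq_abs]
    have hr : ∫ X in boxN N L, ∑ p : Fin N × Fin 3,
          ‖fderiv ℝ g X (Pi.single p.1 (EuclideanSpace.single p.2 (1 : ℝ)))‖ ^ 2 =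
        ∫ X in cellN N L, gradDot φ φ X := by
      rw [hcell]
      refine setIntegral_congr_fun (measurableSet_cellN N L) fun X hX => ?_
      simp only [heq' X hX, Real.norm_eq_abs, gradDot, pderiv, Fintype.sum_prod_type, pow_two,
        abs_mul_abs_self]
    rw [← hl, ← hr]
    exact hPg
  -- integrability facts
  have iφ2F : IntegrableOn (fun X => φ X ^ 2 * F X ^ 2) (cellN N L) :=
    integrableOn_cellN ((hφ.continuous.pow 2).mul (hFc.pow 2)) L
  have iφF : IntegrableOn (fun X => φ X * F X ^ 2) (cellN N L) :=
    integrableOn_cellN (hφ.continuous.mul (hFc.pow 2)) L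
  have iF : IntegrableOn (fun X => F X ^ 2) (cellN N L) := integrableOn_cellN (hFc.pow 2) L
  have iφc2F : IntegrableOn (fun X => (φ X - c) ^ 2 * F X ^ 2) (cellN N L) :=
    integrableOn_cellN (((hφ.continuous.sub continuous_const).pow 2).mul (hFc.pow 2)) L
  have iφc2 : IntegrableOn (fun X => (φ X - c) ^ 2) (cellN N L) :=
    integrableOn_cellN ((hφ.continuous.sub continuous_const).pow 2) L
  have igrad : IntegrableOn (fun X => gradDot φ φ X) (cellN N L) :=
    integrableOn_cellN (continuous_gradDot hφ.contDiff hφ.contDiff) L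
  have igradF : IntegrableOn (fun X => gradDot φ φ X * F X ^ 2) (cellN N L) :=
    integrableOn_gradDot_mul_sq hFc hφ.contDiff hφ.contDiff L
  -- variance ≤ second moment about `c`
  have hnorm : ∫ X in cellN N L, F X ^ 2 = 1 := integral_norm_sq_eq_one Φ
  have hexp : ∫ X in cellN N L, (φ X - c) ^ 2 * F X ^ 2 =
      (∫ X in cellN N L, φ X ^ 2 * F X ^ 2) - 2 * c * (∫ X in cellN N L, φ X * F X ^ 2) + c ^ 2 := by
    have hpt : ∀ X, (φ X - c) ^ 2 * F X ^ 2 =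
        φ X ^ 2 * F X ^ 2 - 2 * c * (φ X * F X ^ 2) + c ^ 2 * F X ^ 2 := fun X => by ring
    simp_rw [hpt]
    have hA : Integrable (fun X => φ X ^ 2 * F X ^ 2 - 2 * c * (φ X * F X ^ 2))
        (volume.restrict (cellN N L)) := iφ2F.sub (iφF.const_mul _)
    rw [integral_add hA (iF.const_mul _), integral_sub iφ2F (iφF.const_mul _), integral_const_mul,
      integral_const_mul, hnorm, mul_one]
  have hvar : (∫ X in cellN N L, φ X ^ 2 * F X ^ 2) - (∫ X in cellN N L, φ X * F X ^ 2) ^ 2 ≤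
      ∫ X in cellN N L, (φ X - c) ^ 2 * F X ^ 2 := by
    rw [hexp]
    nlinarith [sq_nonneg ((∫ X in cellN N L, φ X * F X ^ 2) - c)]
  have h2 : ∫ X in cellN N L, (φ X - c) ^ 2 * F X ^ 2 ≤ M ^ 2 * ∫ X in cellN N L, (φ X - c) ^ 2 := by
    rw [← integral_const_mul]
    refine setIntegral_mono_on iφc2F (iφc2.const_mul _) (measurableSet_cellN N L) fun X hX => ?_
    have hFM : F X ^ 2 ≤ M ^ 2 := by
      have h := hM X hX
      rw [abs_of_nonneg (hFpos X).le] at h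
      nlinarith [hFpos X]
    nlinarith [sq_nonneg (φ X - c)]
  have h3 : ∫ X in cellN N L, gradDot φ φ X ≤
      (1 / F X₀ ^ 2) * dirichletFormW L F φ φ := by
    unfold dirichletFormW
    rw [← integral_const_mul]
    refine setIntegral_mono_on igrad (igradF.const_mul _) (measurableSet_cellN N L) fun X hX => ?_
    have hg0 := gradDot_self_nonneg φ X
    have hmF : F X₀ ^ 2 ≤ F X ^ 2 := by nlinarith [hmle X hX, hmpos]
    rw [one_div, ← div_eq_inv_mul, le_div_iff₀ (by positivity)]
    nlinarith
  calc (∫ X in cellN N L, φ X ^ 2 * F X ^ 2) - (∫ X in cellN N L, φ X * F X ^ 2) ^ 2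
      ≤ ∫ X in cellN N L, (φ X - c) ^ 2 * F X ^ 2 := hvar
    _ ≤ M ^ 2 * ∫ X in cellN N L, (φ X - c) ^ 2 := h2
    _ ≤ M ^ 2 * ((L / Real.pi) ^ 2 * ∫ X in cellN N L, gradDot φ φ X) :=
        mul_le_mul_of_nonneg_left h1 (by positivity)
    _ ≤ M ^ 2 * ((L / Real.pi) ^ 2 * ((1 / F X₀ ^ 2) * dirichletFormW L F φ φ)) :=
        mul_le_mul_of_nonneg_left (mul_le_mul_of_nonneg_left h3 (by positivity)) (by positivity)
    _ = M ^ 2 * (L / Real.pi) ^ 2 / F X₀ ^ 2 * dirichletFormW L F φ φ := by ring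

end Poincare

/-! ### Translation by half a wavelength flips the sign of the density wave -/

section Translate

/-- `cos(p·(x + L e_a)) = cos(p·x)` for `p = 2πk/L`, `k ∈ ℤ³`. [folklore] -/
theorem cos_arg_add_single (hL : L ≠ 0) (k : Fin 3 → ℤ) (x : Space) (a : Fin 3) :
    Real.cos (arg L k (x + EuclideanSpace.single a L)) = Real.cos (arg L k x) := by
  rw [arg_add_single hL, show arg L k x + 2 * Real.pi * (k a : ℝ) =
    arg L k x + ((k a : ℤ) : ℝ) * (2 * Real.pi) by ring, Real.cos_add_int_mul_two_pi]

/-- The density wave `∑ⱼ cos(p·xⱼ)` is `Lℤ³`-periodic in every particle. [folklore] -/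
theorem sum_cos_add_single (hL : L ≠ 0) (k : Fin 3 → ℤ) (X : Config N) (i : Fin N) (a : Fin 3) :
    (∑ j, Real.cos (arg L k ((X + Pi.single i (EuclideanSpace.single a L) : Config N) j)))
      = ∑ j, Real.cos (arg L k (X j)) := by
  refine Finset.sum_congr rfl fun j _ => ?_
  rw [Pi.add_apply]
  rcases eq_or_ne j i with rfl | hji
  · rw [Pi.single_eq_same, cos_arg_add_single hL]
  · rw [Pi.single_eq_of_ne hji, add_zero]

/-- **Half-wavelength translation.** For `k ≠ 0`, translating all bosons by
`τ = (L/2|k|²) k` (so that `p·τ = π`, `p = 2πk/L`) maps a periodic trial state `Φ` to a periodic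
trial state `Ψ = Φ(· - τ𝟙)` with the same energy (for every pair potential) and the OPPOSITE
density-wave mean, `⟨∑ⱼcos(p·xⱼ)⟩_Ψ = -⟨∑ⱼcos(p·xⱼ)⟩_Φ` (shift of the fundamental cell,
`cos(θ + π) = -cos θ`). This is where `k ≠ 0` enters: `E′(0) = ⟨∑cos⟩_{Φ₀} = 0`.
[folklore] -/
theorem exists_translate_cosMean_eq_neg (hL : 0 < L) {k : Fin 3 → ℤ} (hk : k ≠ 0)
    (Φ : PeriodicTrialState N L) :
    ∃ Ψ : PeriodicTrialState N L, (∃ T : Config N, Ψ.ψ = fun X => Φ.ψ (X - T)) ∧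
      (∀ v : ℝ → ℝ≥0∞, periodicEnergy v Ψ = periodicEnergy v Φ) ∧
      cosMean L k Ψ = -cosMean L k Φ := by
  set κ : ℝ := ∑ i, (k i : ℝ) ^ 2 with hκ
  have hκpos : 0 < κ := by
    obtain ⟨i, hi⟩ : ∃ i, k i ≠ 0 := by
      by_contra h
      push Not at h
      exact hk (funext h)
    have hi' : (0 : ℝ) < (k i : ℝ) ^ 2 := by
      have : (k i : ℝ) ≠ 0 := by exact_mod_cast hi
      positivity
    exact Finset.sum_pos' (fun j _ => sq_nonneg _) ⟨i, Finset.mem_univ _, hi'⟩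
  set τ : Space := WithLp.toLp 2 fun i => L / (2 * κ) * (k i : ℝ) with hτ
  obtain ⟨Ψ, hΨ⟩ := Φ.exists_translate τ
  refine ⟨Ψ, ⟨fun _ => τ, hΨ⟩, fun v => periodicEnergy_translate v Φ τ hΨ, ?_⟩
  have hphase : ∀ x : Space, arg L k (x + τ) = arg L k x + Real.pi := by
    intro x
    have hsum : ∑ i, (k i : ℝ) * (x + τ) i = (∑ i, (k i : ℝ) * x i) + L / (2 * κ) * κ := by
      rw [hκ, Finset.mul_sum, ← Finset.sum_add_distrib]
      refine Finset.sum_congr rfl fun i _ => ?_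
      rw [PiLp.add_apply, hτ, PiLp.toLp_apply]
      ring
    unfold arg
    rw [hsum, mul_add]
    congr 1
    field_simp
  -- the shifted integrand
  set G : Config N → ℝ := fun X =>
    (∑ j, Real.cos (arg L k ((X + fun _ => τ : Config N) j))) * ‖Φ.ψ X‖ ^ 2 with hG
  have hGper : ∀ (X : Config N) (i : Fin N) (a : Fin 3),
      G (X + Pi.single i (EuclideanSpace.single a L)) = G X := by
    intro X i a
    simp only [hG]
    rw [Φ.periodic X i a, add_right_comm, sum_cos_add_single hL.ne' k]
  have hcos : cosMean L k Ψ = ∫ X in cellN N L, G (X + -fun _ => τ) := by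
    unfold cosMean
    rw [hΨ]
    congr 1 with X
    simp only [hG, arg, sub_eq_add_neg, Pi.add_apply, Pi.neg_apply, neg_add_cancel_right]
  rw [hcos, setIntegral_cellN_comp_add hL hGper, cosMean, ← integral_neg]
  congr 1 with X
  simp only [hG]
  rw [← neg_mul]
  congr 1
  rw [← Finset.sum_neg_distrib]
  refine Finset.sum_congr rfl fun j _ => ?_
  rw [Pi.add_apply, hphase, Real.cos_add_pi]
  rfl

end Translate

/-! ### Two lemmas of real analysis -/

section RealAnalysis

/-- **Monotonicity from a local one-sided bound** (a Dini-derivative lemma): if `g` is continuous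
on `[a, b]` and at every `x ∈ [a, b)` satisfies `g(z) - g(x) ≥ -A_x (z - x)²` for all `z ∈ (x, b]`
close to `x`, then `g(a) ≤ g(b)` (Mathlib's `image_le_of_liminf_slope_right_le_deriv_boundary`
applied to `-g` with the constant barrier `-g(a)`). [folklore] -/
theorem le_of_local_lower_bound {g : ℝ → ℝ} {a b : ℝ} (hab : a ≤ b)
    (hcont : ContinuousOn g (Set.Icc a b))
    (hloc : ∀ x ∈ Set.Ico a b, ∃ A h : ℝ, 0 < h ∧
      ∀ z, x < z → z < x + h → z ≤ b → -A * (z - x) ^ 2 ≤ g z - g x) :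
    g a ≤ g b := by
  have key := image_le_of_liminf_slope_right_le_deriv_boundary (f := fun x => -g x) (a := a) (b := b)
    hcont.neg (B := fun _ => -g a) (B' := fun _ => 0) le_rfl continuousOn_const
    (fun x _ => hasDerivWithinAt_const x _ _) ?_ (Set.right_mem_Icc.2 hab)
  · linarith
  intro x hx r hr
  obtain ⟨A, h, hh, hAz⟩ := hloc x hx
  have hxb : x < b := hx.2
  set d : ℝ := min (min h (b - x)) (r / (|A| + 1)) with hd
  have hdpos : 0 < d := lt_min (lt_min hh (by linarith)) (by positivity)
  have hev : ∀ᶠ z in 𝓝[>] x, slope (fun x => -g x) x z < r := by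
    filter_upwards [Ioo_mem_nhdsGT (show x < x + d by linarith)] with z hz
    rw [Set.mem_Ioo] at hz
    have hzx : 0 < z - x := by linarith
    have hzh : z < x + h := by
      have : d ≤ h := (min_le_left _ _).trans (min_le_left _ _); linarith
    have hzb : z ≤ b := by
      have : d ≤ b - x := (min_le_left _ _).trans (min_le_right _ _); linarith
    have hzr : z - x < r / (|A| + 1) := by
      have : d ≤ r / (|A| + 1) := min_le_right _ _; linarith
    have hb := hAz z hz.1 hzh hzb
    rw [slope_def_field, div_lt_iff₀ hzx]
    have h1 : -(g z - g x) ≤ A * (z - x) ^ 2 := by linarith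
    have h2 : A * (z - x) ^ 2 ≤ |A| * (z - x) * (z - x) := by
      rw [sq, ← mul_assoc]
      exact mul_le_mul_of_nonneg_right (mul_le_mul_of_nonneg_right (le_abs_self A) hzx.le) hzx.le
    have h3 : |A| * (z - x) < r := by
      calc |A| * (z - x) ≤ |A| * (r / (|A| + 1)) := mul_le_mul_of_nonneg_left hzr.le (abs_nonneg A)
        _ < r := by
          rw [mul_div_assoc']
          rw [div_lt_iff₀ (by positivity)]
          nlinarith [abs_nonneg A]
    nlinarith
  exact hev.frequently

/-- `∑_{i<m} (i + 1) = m(m+1)/2` in `ℝ`. [folklore] -/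
theorem sum_range_cast_add_one (m : ℕ) :
    ∑ i ∈ Finset.range m, ((i : ℝ) + 1) = (m : ℝ) * ((m : ℝ) + 1) / 2 := by
  induction m with
  | zero => simp
  | succ n ih =>
    rw [Finset.sum_range_succ, ih]
    push_cast
    ring

/-- **Discrete Taylor lower bound.** Let `e, f : ℝ → ℝ` satisfy on `[0, r]` the lower tangent
inequality `(s' - s) f(s') ≤ e(s') - e(s)` (`0 ≤ s < s' ≤ r`) and let `s ↦ f(s) + 2Ks` be
non-decreasing there (`K ≥ 0`). Then `e(t) ≥ e(0) + t f(0) - K t²` for `t ∈ [0, r]`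
(telescope over the uniform partition of `[0, t]` into `m` pieces and let `m → ∞`:
`∑ δ f(sᵢ) ≥ t f(0) - 2Kδ² m(m+1)/2`). For `e = E`, `f = E′` this is Taylor's formula with
`E″ ≥ -2K`. [folklore] -/
theorem le_of_lower_tangent_of_monotone {e f : ℝ → ℝ} {r K : ℝ} (hK : 0 ≤ K)
    (hsand : ∀ s s', 0 ≤ s → s < s' → s' ≤ r → (s' - s) * f s' ≤ e s' - e s)
    (hmono : ∀ s s', 0 ≤ s → s ≤ s' → s' ≤ r → f s + 2 * K * s ≤ f s' + 2 * K * s')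
    {t : ℝ} (ht0 : 0 ≤ t) (htr : t ≤ r) :
    e 0 + t * f 0 - K * t ^ 2 ≤ e t := by
  rcases ht0.eq_or_lt with rfl | htpos
  · simp
  -- for every `m ≥ 1`: `e t - e 0 ≥ t f 0 - K t² - K t²/m`
  have key : ∀ m : ℕ, 0 < m → e 0 + t * f 0 - K * t ^ 2 - K * t ^ 2 / m ≤ e t := by
    intro m hm
    have hmR : (0 : ℝ) < m := by exact_mod_cast hm
    set δ : ℝ := t / m with hδ
    have hδpos : 0 < δ := by positivity
    have hmδ : (m : ℝ) * δ = t := by rw [hδ]; field_simp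
    -- telescoping
    have htel : ∑ i ∈ Finset.range m, (e (((i + 1 : ℕ) : ℝ) * δ) - e ((i : ℝ) * δ)) =
        e t - e 0 := by
      rw [Finset.sum_range_sub (fun i : ℕ => e ((i : ℝ) * δ)) m, hmδ, Nat.cast_zero, zero_mul]
    -- termwise lower bound
    have hterm : ∀ i ∈ Finset.range m,
        δ * (f 0 - 2 * K * (((i : ℝ) + 1) * δ)) ≤ e (((i + 1 : ℕ) : ℝ) * δ) - e ((i : ℝ) * δ) := by
      intro i hi
      rw [Finset.mem_range] at hi
      have hi1 : ((i : ℝ) + 1) * δ ≤ r := by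
        have : ((i : ℝ) + 1) ≤ m := by exact_mod_cast hi
        calc ((i : ℝ) + 1) * δ ≤ m * δ := mul_le_mul_of_nonneg_right this hδpos.le
          _ = t := hmδ
          _ ≤ r := htr
      have hi0 : 0 ≤ (i : ℝ) * δ := by positivity
      have h1 := hsand ((i : ℝ) * δ) (((i : ℝ) + 1) * δ) hi0 (by nlinarith) hi1
      have h2 := hmono 0 (((i : ℝ) + 1) * δ) le_rfl (by positivity) hi1
      push_cast
      nlinarith
    have hsum := Finset.sum_le_sum hterm
    rw [htel] at hsum
    have hcomp : ∑ i ∈ Finset.range m, δ * (f 0 - 2 * K * (((i : ℝ) + 1) * δ)) =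
        t * f 0 - K * t ^ 2 - K * t ^ 2 / m := by
      have : ∑ i ∈ Finset.range m, δ * (f 0 - 2 * K * (((i : ℝ) + 1) * δ)) =
          ∑ i ∈ Finset.range m, (δ * f 0 - 2 * K * δ ^ 2 * ((i : ℝ) + 1)) :=
        Finset.sum_congr rfl fun i _ => by ring
      rw [this, Finset.sum_sub_distrib, Finset.sum_const, Finset.card_range, ← Finset.mul_sum,
        sum_range_cast_add_one, nsmul_eq_mul]
      rw [hδ]
      field_simp
      ring
    linarith
  -- let `m → ∞`
  refine le_of_forall_pos_le_add fun ε hε => ?_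
  obtain ⟨m, hm⟩ := exists_nat_gt (K * t ^ 2 / ε)
  have hmpos : 0 < m := by
    have : (0 : ℝ) < m := lt_of_le_of_lt (by positivity) hm
    exact_mod_cast this
  have h := key m hmpos
  have hmR : (0 : ℝ) < m := by exact_mod_cast hmpos
  have : K * t ^ 2 / m ≤ ε := by
    rw [div_le_iff₀ hmR]
    rw [div_lt_iff₀ hε] at hm
    linarith
  linarith

end RealAnalysis

/-- **Registered form (sub-goal `stub_modulationPoincareConst` of stub S3).** A weighted Poincaré
(variance) constant for `|Φ|² dX`, `Φ > 0`, as a closed statement (`exists_poincareConst`).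
[folklore] -/
theorem stub_modulationPoincareConst :
    ∀ (N : ℕ) (L : ℝ), 0 < L → ∀ Φ : PeriodicTrialState N L, (∀ X, Φ.ψ X = (‖Φ.ψ X‖ : ℂ)) →
      (∀ X, Φ.ψ X ≠ 0) → ∃ C : ℝ, 0 ≤ C ∧ ∀ φ : Config N → ℝ, IsPeriodicTest L φ →
        (∫ X in cellN N L, φ X ^ 2 * ‖Φ.ψ X‖ ^ 2) - (∫ X in cellN N L, φ X * ‖Φ.ψ X‖ ^ 2) ^ 2 ≤
          C * dirichletFormW L (fun X => ‖Φ.ψ X‖) φ φ :=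
  fun _N _L hL Φ hreal hpos => exists_poincareConst hL Φ hreal hpos

end Summit.AtomisticToContinuum.BoseEinsteinCondensation.Cruxes.StaticResponseBound.UvThomsonForceWave

end
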